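import Literature.NumberTheory.Rogawski1990.ArchCartanWallExtensionGDocks   -- ★ p850260∕p850265 (LH3-p02 (g2)): docks (normal curve in `RegG`, `hasOneSidedJump_hcTwistedDeriv_orbFamGExt_iff`), `orbFamGExt`
import Literature.NumberTheory.Rogawski1990.ArchTransfFamilyJumpKit         -- ★ (LH7-p02 (g2)): `hasOneSidedJump_mul_of_tendsto`, `hasOneSidedJump_congr_eventuallyEq`
import HarnessLib

/-!
# (J-G′-JUMP), SHELL: the order-0 jump of the extended genuine `G′`-family at a covered compact wall FROM NAMED BRICKS — descent-to-block formula, rank-one jump, wall factor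
# (Harish-Chandra's descent + the `U(1,1)` jump; Rogawski 1990 §4.12, §8.2 pp. 119–124; Shelstad 1979 Lemma 4.3, Prop. 4.5; Varadarajan 1989 §6.4)

Topic `NumberTheory/Rogawski1990`; namespace `Literature.NumberTheory.Rogawski1990`.  THEOREMS ONLY (no definition, no instance, no notation, no axiom, no named fact, no `sorry`);
kernel lane `--kind proof --supports stmt-HodgeConjecture-24833`.  Cell `pub/hodgecm-mathlib`, crux H413 (`stmt-HodgeConjecture-24833`), F0∕P3c line LH3 (closer stub `stub_N9`,
DIRECT ROAD `F0_P3c_StubN9Direct`, organ J `JumpAgreementStatement`): brick **(J-G′-JUMP)** (LH3-plan (g3) RULINGS #5, 2026-09-02T07:43:07Z, «= OWN» LH3-p02 (g2)), piece (a) = the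
ASSEMBLY SHELL with its three analytic inputs BY STATEMENT (interfaces fixed, as (J-HEAD) does for organ J); pieces (b) (J-G′-BLOCK: the descent-to-block formula `hdesc` from
(J-DESC) D4b) and (c) (the transported rank-one jump `hjump` from (K0±-FORM-TRANSPORT); the wall factor `hwall` from ★ p850207) instantiate it.

THE MATHEMATICS.  At a covered compact wall `(w, 0, 2)` of an admissible `G′`-chart `S` (`w ∉ S`; slots `0`, `2` carry lines of opposite sign) and a semiregular wall point `p`
(★ `HcSemireg S w 0 2 p`), read the genuine family along the normal `c_ν = p + ν • hcNrm w 0 2` (angles `θ₀ + ν`, `θ₁`, `θ₀ − ν` at `w`).  For small `ν ≠ 0`, `c_ν ∈ RegG S` (★ docks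
`eventually_add_smul_hcNrm_mem_regG`), so the EXTENDED family is the RAW one there: `orbFamGExt … S c_ν = archRG S c_ν · chartOrbG ν′ S a′ c_ν` (★ `orbFamGExt_of_mem_regG_of_admissible`),
and (I₃)'s order-0 left side `hcTwistedDeriv S 0 · (orbFamGExt …) c_ν = archERhoG S c_ν · orbFamGExt … c_ν` (★ `hcTwistedDeriv_zero`).  Three inputs: (WALL) the `ρ`-twisted
normaliser factorises `archERhoG S c_ν · archRG S c_ν = 2 sin ν · R(ν)` with `R` continuous at `0` (★ p850207: at `w` the `(0,2)`-root gives `e^{iν}(1 − e^{−2iν}) = 2i sin ν`, the two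
other roots tend to `|e^{iθ₀} − e^{iθ₁}|²`, the other places are constant); (DESC) Harish-Chandra's descent to `M = Z_{G′_∞}(γ_p) ≅ U(1,1)_w × U(1)_w × ∏_{v≠w} T_v` reads the
quotient orbital integral as `chartOrbG ν′ S a′ c_ν = K · Φ(ν)`, `Φ(ν)` = the `U(1,1)`-block orbital integral of ONE descended test function at `z·diag(e^{iν}, e^{−iν})` [Rogawski1990,
§4.12; HC–van Dijk LNM 162 §3]; (K0) the rank-one jump `2 sin ν · Φ(ν) → ±C₁·cone^±` [Varadarajan1989 §6.4 Thm 23; Shelstad 1979 Lemma 4.3] in ★ `HasOneSidedJump` form with jump `J_b`.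
Then `archERhoG · orbFamGExt (c_ν) = (R(ν)·K) · (2 sin ν · Φ(ν))` for small `ν ≠ 0`, and ★ `hasOneSidedJump_mul_of_tendsto` gives the jump `r·K·J_b`, `r = R(0)`.

* §1 `archERhoG_mul_orbFamGExt_add_smul_hcNrm_eventuallyEq` — the displayed factorisation, eventually along `𝓝[≠] 0`, from (WALL) and (DESC).
* §2 **`hasOneSidedJump_archERhoG_mul_orbFamGExt_of_bricks (hS) (hw) (hp) (hdesc) (hjump) (hwall) (hR) : HasOneSidedJump (fun ν => archERhoG S (p + ν • hcNrm w 0 2) *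
  orbFamGExt L α ν′ a′ S (p + ν • hcNrm w 0 2)) (r * K * Jb)`** and the (I₃)-currency form **`hasOneSidedJump_hcTwistedDeriv_orbFamGExt_of_bricks … (dirs : Fin 0 → _) :
  HasOneSidedJump (fun ν => hcTwistedDeriv S 0 dirs (orbFamGExt L α ν′ a′ S) (p + ν • hcNrm w 0 2)) (r * K * Jb)`**; the RAW twin `hasOneSidedJump_archERhoG_mul_orbFamG_of_bricks`.
HONEST LABEL: HC_CM is proved only modulo the 7 printed citations (2 remaining: hLiu418 = `stmt-HodgeConjecture-24832`, h413 = `stmt-HodgeConjecture-24833`) until rung 0 closes;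
count-neutral (an assembler: the analytic content sits in the three hypotheses, each a named brick of the line).

## References
* [Rogawski1990] J. D. Rogawski, *Automorphic Representations of Unitary Groups in Three Variables*, Ann. of Math. Stud. 123 (1990), §4.12 Lemma 4.12.1 p. 66, §8.2 pp. 119–124.
* [Shelstad1979] D. Shelstad, *Characters and inner forms of a quasi-split group over ℝ*, Compositio Math. 39 (1979), Lemma 4.3 p. 25, Prop. 4.5 p. 26.
* [Varadarajan1989] V. S. Varadarajan, *An Introduction to Harmonic Analysis on Semisimple Lie Groups* (1989), §6.4 Thms 18, 20, 23.
* [Varadarajan1977] V. S. Varadarajan, *Harmonic Analysis on Real Reductive Groups*, LNM 576 (1977), Part I §1.12.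
-/

set_option autoImplicit false

noncomputable section

open MeasureTheory MeasureTheory.Measure NumberField NumberField.InfinitePlace Matrix Complex Set Filter Topology
open scoped MatrixGroups Matrix Real Classical
open Literature.NumberTheory.Automorphic Literature.NumberTheory.Automorphic.UnitaryGroup Literature.NumberTheory.Automorphic.ArchCartan
open Literature.NumberTheory.Automorphic.Shelstad1979.StableOrbitalIntegrals
open Literature.NumberTheory.GaloisRepresentations

namespace Literature.NumberTheory.Rogawski1990

variable (L : Type) [Field L] [NumberField L] [IsCMField L] (α : Fin 3 → L)
  [MeasurableSpace ↥(arch (↥(maximalRealSubfield L)) L (IsCMField.complexConj L) 3 (Matrix.diagonal α))] [BorelSpace ↥(arch (↥(maximalRealSubfield L)) L (IsCMField.complexConj L) 3 (Matrix.diagonal α))]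
  (ν' : Measure ↥(arch (↥(maximalRealSubfield L)) L (IsCMField.complexConj L) 3 (Matrix.diagonal α))) [IsFiniteMeasureOnCompacts ν'] [ν'.IsMulRightInvariant]
  (a' : ↥(arch (↥(maximalRealSubfield L)) L (IsCMField.complexConj L) 3 (Matrix.diagonal α)) → ℂ)
  {S : Finset {w : InfinitePlace L // IsComplex w}} (hS : ∀ v, v ∈ S → v ∈ splitChartPlaces L α)
  {w : {w : InfinitePlace L // IsComplex w}} (hw : w ∉ S)
  {p : {w : InfinitePlace L // IsComplex w} → Fin 3 → ℝ} (hp : HcSemireg S w 0 2 p)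
  -- (DESC): the descent-to-block formula along the normal, for small `ν ≠ 0`
  {K : ℂ} {Φ : ℝ → ℂ} (hdesc : ∀ᶠ ν in 𝓝[≠] (0 : ℝ), chartOrbG L α ν' S a' (p + ν • hcNrm w 0 2) = K * Φ ν)
  -- (K0): the transported rank-one jump of the block orbital integral
  {Jb : ℂ} (hjump : HasOneSidedJump (fun ν : ℝ => (2 * Real.sin ν : ℂ) * Φ ν) Jb)
  -- (WALL): the `ρ`-twisted normaliser along the normal
  {R : ℝ → ℂ} {r : ℂ} (hwall : ∀ ν : ℝ, archERhoG S (p + ν • hcNrm w 0 2) * archRG S (p + ν • hcNrm w 0 2) = (2 * Real.sin ν : ℂ) * R ν)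
  (hR : Tendsto R (𝓝 (0 : ℝ)) (𝓝 r))

/-! ## §1 The factorisation along the normal -/

include hS hw hp hdesc hwall in
/-- **Along the normal, for small `ν ≠ 0`: `archERhoG S c_ν · orbFamGExt … S c_ν = (R(ν)·K) · (2 sin ν · Φ(ν))`** — the curve is in `RegG S` (★ docks), where the extended family
is the raw `archRG · chartOrbG` (admissible label), and (WALL) ∕ (DESC) factor the two pieces. [cite: Rogawski1990, §8.2 pp. 119–124; §4.12 p. 66] [cite: Shelstad1979, Lemma 4.3 p. 25] -/
theorem archERhoG_mul_orbFamGExt_add_smul_hcNrm_eventuallyEq :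
    (fun ν : ℝ => archERhoG S (p + ν • hcNrm w 0 2) * orbFamGExt L α ν' a' S (p + ν • hcNrm w 0 2)) =ᶠ[𝓝[≠] (0 : ℝ)]
      fun ν : ℝ => (R ν * K) * ((2 * Real.sin ν : ℂ) * Φ ν) := by
  have h02 : (0 : Fin 3) ≠ 2 := by decide
  filter_upwards [eventually_add_smul_hcNrm_mem_regG hw h02 hp, hdesc] with ν hν hν'
  rw [orbFamGExt_of_mem_regG_of_admissible L α ν' a' S hS hν, ← mul_assoc, hwall ν, hν']
  ring

include hS hw hp hdesc hwall in
/-- The same factorisation for the RAW family `orbFamG` (on `RegG S` the two families agree). [cite: Rogawski1990, §8.2 pp. 119–124] -/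
theorem archERhoG_mul_orbFamG_add_smul_hcNrm_eventuallyEq :
    (fun ν : ℝ => archERhoG S (p + ν • hcNrm w 0 2) * orbFamG L α ν' a' S (p + ν • hcNrm w 0 2)) =ᶠ[𝓝[≠] (0 : ℝ)]
      fun ν : ℝ => (R ν * K) * ((2 * Real.sin ν : ℂ) * Φ ν) := by
  have h02 : (0 : Fin 3) ≠ 2 := by decide
  filter_upwards [eventually_add_smul_hcNrm_mem_regG hw h02 hp, hdesc] with ν hν hν'
  rw [orbFamG_apply L α ν' a' hS, ← mul_assoc, hwall ν, hν']
  ring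

/-! ## §2 The jump from the bricks -/

include hS hw hp hdesc hjump hwall hR in
/-- **(J-G′-JUMP) FROM NAMED BRICKS**: the `ρ`-twisted extended genuine family, read along the normal of a semiregular point of a covered compact wall, has both one-sided limits at
`ν = 0` and jumps by `r · K · J_b` — `r = lim R` the regular wall factor, `K` the descent constant, `J_b` the rank-one block jump (★ `hasOneSidedJump_mul_of_tendsto` on §1).
[cite: Rogawski1990, §8.2 pp. 119–124; §4.12 Lemma 4.12.1 p. 66] [cite: Shelstad1979, Prop. 4.5 (p. 26)] [cite: Varadarajan1989, §6.4 Thm 23] -/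
theorem hasOneSidedJump_archERhoG_mul_orbFamGExt_of_bricks :
    HasOneSidedJump (fun ν : ℝ => archERhoG S (p + ν • hcNrm w 0 2) * orbFamGExt L α ν' a' S (p + ν • hcNrm w 0 2)) (r * K * Jb) := by
  have hA : Tendsto (fun ν : ℝ => R ν * K) (𝓝 (0 : ℝ)) (𝓝 (r * K)) := hR.mul tendsto_const_nhds
  exact (hasOneSidedJump_congr (archERhoG_mul_orbFamGExt_add_smul_hcNrm_eventuallyEq L α ν' a' hS hw hp hdesc hwall) _).2
    (hasOneSidedJump_mul_of_tendsto hA hjump)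

include hS hw hp hdesc hjump hwall hR in
/-- The RAW twin: the same jump for `archERhoG S · orbFamG …` along the normal. [cite: Rogawski1990, §8.2 pp. 119–124] [cite: Shelstad1979, Prop. 4.5 (p. 26)] -/
theorem hasOneSidedJump_archERhoG_mul_orbFamG_of_bricks :
    HasOneSidedJump (fun ν : ℝ => archERhoG S (p + ν • hcNrm w 0 2) * orbFamG L α ν' a' S (p + ν • hcNrm w 0 2)) (r * K * Jb) := by
  have hA : Tendsto (fun ν : ℝ => R ν * K) (𝓝 (0 : ℝ)) (𝓝 (r * K)) := hR.mul tendsto_const_nhds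
  exact (hasOneSidedJump_congr (archERhoG_mul_orbFamG_add_smul_hcNrm_eventuallyEq L α ν' a' hS hw hp hdesc hwall) _).2
    (hasOneSidedJump_mul_of_tendsto hA hjump)

include hS hw hp hdesc hjump hwall hR in
/-- **(I₃)-CURRENCY FORM**: the order-0 twisted derivative `hcTwistedDeriv S 0 · (orbFamGExt …)` along the normal (= `archERhoG · orbFamGExt`, ★ `hcTwistedDeriv_zero`) jumps by
`r · K · J_b` — literally the left side of ★ `ArchHcJump` at `n = 0` for the extended genuine family. [cite: Bouaziz1994IntegralesOrbitales, §3.2 (I₃) p. 580] [cite: Shelstad1979, Prop. 4.5 (p. 26)] -/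
theorem hasOneSidedJump_hcTwistedDeriv_orbFamGExt_of_bricks (dirs : Fin 0 → ({w : InfinitePlace L // IsComplex w} → Fin 3 → ℝ)) :
    HasOneSidedJump (fun ν : ℝ => hcTwistedDeriv S 0 dirs (orbFamGExt L α ν' a' S) (p + ν • hcNrm w 0 2)) (r * K * Jb) := by
  have h := hasOneSidedJump_archERhoG_mul_orbFamGExt_of_bricks L α ν' a' hS hw hp hdesc hjump hwall hR
  refine (hasOneSidedJump_congr (Filter.Eventually.of_forall fun ν => ?_) _).2 h
  exact hcTwistedDeriv_zero S dirs _ _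

end Literature.NumberTheory.Rogawski1990

end
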